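import Mathlib.CategoryTheory.Whiskering
import Literature.AnabelianGeometry.SemiGraphs.RelCosetCategories
import Literature.AnabelianGeometry.SemiGraphs.CosetCategoriesPushPullBridge
import HarnessLib

/-!
# The small model of [FrdII] Ex. 1.3 (iii)'s functor `𝓑^temp(Π, Π°)⁰ → 𝓑^temp(G_F)⁰` IS the printed composite

Mochizuki, *The geometry of Frobenioids II*, Kyushu J. Math. **62** (2008), §1 Example 1.3 (iii), author's text pp. 11–12
[cite: MochizukiFrdII2008, Ex 1.3 (iii) pp.11-12]: "any open homomorphism `Π → Q` from a tempered topological group `Π`,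
equipped with an open subgroup `Π° ⊆ Π`, to a quotient `G_F ↠ Q` of the absolute Galois group `G_F` … determines a functor
`𝓑^temp(Π, Π°)⁰ ↪ 𝓑^temp(Π)⁰ → 𝓑^temp(Q)⁰ ↪ 𝓑^temp(G_F)⁰` [where the middle arrow '→' is a functor as in (ii)]".

The tree's printed composite on the BIG models is abc-iut-L1-t4's `QuasiTemperoid.galoisBaseFunctor F Π Π° Q φ π`
(`relInclusion ⋙ inductionFunctorConnected φ ⋙ pullback π`, `QuasiTemperoidGaloisBase.lean`). On the SMALL coset models
(abc-iut-L5-t2's `CosetCat`, abc-iut-L1-t4's `RelCosetCat`, the Datum-compatible bases of [FrdII] §1–§2) the same three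
arrows are `RelCosetCat.incl Π° ⋙ CosetCat.push φ ⋙ CosetCat.pull π`. This file proves that the two agree along the
model equivalences (`RelCosetCat.toRelConnected`, `CosetCat.toConnected`):

* `RelCosetCat.toRelConnected_comp_relInclusion` — the first arrow: `toRelConnected ⋙ relInclusion = incl ⋙ toConnected`
  (on the nose); `RelCosetCat.pushRel φ : RelCosetCat Π° ⥤ RelCosetCat φ(Π°)` — the middle arrow restricted to the relative
  categories (`U ↦ φ(U)`; for `Π ↠ G := Im(Π)` the "natural functor `D → E = 𝓑^temp(G, G°)⁰`" of [FrdII] §2 p. 17);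
  `RelCosetCat.inductionIso` — the §2 form `toRelConnected ⋙ relInclusion ⋙ inductionFunctorConnected φ ≅ (incl ⋙ push φ)
  ⋙ toConnected`;
* `RelCosetCat.galoisBaseFunctorIso` — **`toRelConnected ⋙ galoisBaseFunctor F Π Π° Q φ π ≅ (incl ⋙ push φ ⋙ pull π) ⋙
  toConnected`**, assembled from `CosetCat.pushBridgeIso` (middle arrow) and `CosetCat.pullBridgeIso` (last arrow) of
  `CosetCategoriesPushPullBridge.lean`.
So the base functors `PadicFrd.relBase` / `relBaseGal` of abc-iut-L1-t4's `PadicFrobenioidRelCosetBase.lean` are print's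
functor followed by the Galois correspondence, up to these isomorphisms. Pure category theory over landed files; nothing
of the disputed series is asserted; no statement of the paper is strengthened.
-/

namespace Literature.AnabelianGeometry.SemiGraphs

namespace RelCosetCat

open CategoryTheory Literature.AlgebraicGeometry.Frobenioids Literature.AlgebraicGeometry.Frobenioids.QuasiTemperoid

universe u

variable {G : Type u} [Group G] [TopologicalSpace G] [IsTopologicalGroup G] (hG : IsTempered G) (H : OpenSubgroup G)

/-- The first arrow `𝓑^temp(Π, Π°)⁰ ↪ 𝓑^temp(Π)⁰` on the two models agrees ON THE NOSE: `toRelConnected ⋙ relInclusion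
= incl ⋙ toConnected` (both send `Π/U` to the `Π`-set `Π/U`). [cite: MochizukiFrdII2008, Ex 1.3 (iii) pp.11-12] -/
theorem toRelConnected_comp_relInclusion :
    toRelConnected (H := H) hG ⋙ relInclusion G H.toSubgroup = incl H ⋙ CosetCat.toConnected hG :=
  rfl

section PushRel

variable {Q : Type u} [Group Q] [TopologicalSpace Q] (φ : G →* Q) (ho : IsOpenMap φ)

omit [IsTopologicalGroup G] in
/-- **The middle arrow restricted to the relative categories**: `φ_*` carries `𝓑^temp(Π, Π°)⁰` into `𝓑^temp(Π₂, φ(Π°))⁰`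
(an object over `Π/Π°` goes to an object over `Π₂/φ(Π°)`) — on small models `U ↦ φ(U)`; for `φ` the surjection
`Π ↠ G := Im(Π)` this is the "natural functor `D → E = 𝓑^temp(G, G°)⁰`" of [FrdII] §2 (p. 17).
[cite: MochizukiFrdII2008, Def 2.2 p.17] -/
noncomputable def pushRel : RelCosetCat H ⥤ RelCosetCat (CosetCat.mapOpen φ ho H) :=
  (CosetCat.admitsHomTo (CosetCat.mapOpen φ ho H)).lift (incl H ⋙ CosetCat.push φ ho) fun X =>
    ⟨(CosetCat.push φ ho).map X.property.some⟩

omit [IsTopologicalGroup G] in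
/-- `pushRel` is `CosetCat.push` on underlying coset objects (on the nose). [cite: MochizukiFrdII2008, Def 2.2 p.17] -/
theorem pushRel_comp_incl : pushRel H φ ho ⋙ incl (CosetCat.mapOpen φ ho H) = incl H ⋙ CosetCat.push φ ho := rfl

omit [IsTopologicalGroup G] in
/-- `pushRel` sends the distinguished object `Π/Π°` to `Π₂/φ(Π°)`. [cite: MochizukiFrdII2008, Def 2.2 p.17] -/
theorem pushRel_obj_coset : (pushRel H φ ho).obj (coset H) = coset (CosetCat.mapOpen φ ho H) := rfl

end PushRel

variable {Q : Type u} [Group Q] [TopologicalSpace Q] [IsTopologicalGroup Q] (hQ : IsTempered Q)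
  (F : Type u) [Field F] (hΓ : IsTempered (Field.absoluteGaloisGroup F))
  (φ : G →* Q) (hφ : IsOpenHom φ) (π : Field.absoluteGaloisGroup F →* Q) (hc : Continuous π) (hs : Function.Surjective π)

/-- **The §2 form** (no pull-back; "`G_{ℚ_p} ⥲ Q`"): `𝓑^temp(Π, Π°)⁰ ↪ 𝓑^temp(Π)⁰ →(φ_*) 𝓑^temp(Q)⁰` on the big models
(`relInclusion ⋙ inductionFunctorConnected φ`) is isomorphic to `incl ⋙ CosetCat.push φ` on the small models followed by
`CosetCat.toConnected` (`CosetCat.pushBridgeIso`). [cite: MochizukiFrdII2008, Ex 1.3 (iii) pp.11-12] -/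
noncomputable def inductionIso (hQc : ∀ V : Subgroup Q, IsOpen (V : Set Q) → Countable (Q ⧸ V)) :
    toRelConnected (H := H) hG ⋙ relInclusion G H.toSubgroup ⋙ inductionFunctorConnected φ hφ.isOpenMap hQc ≅
      (incl H ⋙ CosetCat.push φ hφ.isOpenMap) ⋙ CosetCat.toConnected hQ :=
  Functor.isoWhiskerLeft (incl H) (CosetCat.pushBridgeIso hG φ hφ.isOpenMap hQ hQc).symm

/-- **The small model computes [FrdII] Ex. 1.3 (iii)'s functor**: along the model equivalences,
`𝓑^temp(Π, Π°)⁰ ↪ 𝓑^temp(Π)⁰ →(φ_*) 𝓑^temp(Q)⁰ →(π^*) 𝓑^temp(G_F)⁰` (abc-iut-L1-t4's `galoisBaseFunctor`, big models) is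
isomorphic to `incl ⋙ CosetCat.push φ ⋙ CosetCat.pull π` (small models) followed by `CosetCat.toConnected` — from
`CosetCat.pushBridgeIso` and `CosetCat.pullBridgeIso`. (`Q` and `G_F` tempered, e.g. profinite.)
[cite: MochizukiFrdII2008, Ex 1.3 (iii) pp.11-12] -/
noncomputable def galoisBaseFunctorIso :
    toRelConnected (H := H) hG ⋙ galoisBaseFunctor F G H.toSubgroup Q φ π hφ hc hs ≅
      (incl H ⋙ CosetCat.push φ hφ.isOpenMap ⋙ CosetCat.pull π hc hs) ⋙ CosetCat.toConnected hΓ :=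
  Functor.isoWhiskerLeft (incl H)
    (Functor.isoWhiskerRight (CosetCat.pushBridgeIso hG φ hφ.isOpenMap hQ
        (countable_quotient_of_absoluteGaloisGroup F π hc hs)).symm (QuasiTemperoid.pullback π hs hc) ≪≫
      Functor.isoWhiskerLeft (CosetCat.push φ hφ.isOpenMap) (CosetCat.pullBridgeIso hΓ hQ π hc hs).symm)

include hQ in
/-- The same isomorphism, objectwise: for every `Π/U` in `𝓑^temp(Π, Π°)⁰` the `G_F`-set `π^* φ_* (Π/U) = G_F`-set
`Q ×^{Π} (Π/U)` is isomorphic to the coset `G_F`-set `G_F/π⁻¹(φ(U))`. [cite: MochizukiFrdII2008, Ex 1.3 (iii) pp.11-12] -/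
theorem nonempty_galoisBaseFunctor_obj_iso (X : RelCosetCat H) :
    Nonempty ((galoisBaseFunctor F G H.toSubgroup Q φ π hφ hc hs).obj ((toRelConnected hG).obj X) ≅
      (CosetCat.toConnected hΓ).obj ((CosetCat.pull π hc hs).obj ((CosetCat.push φ hφ.isOpenMap).obj X.obj))) :=
  ⟨(galoisBaseFunctorIso hG H hQ F hΓ φ hφ π hc hs).app X⟩

end RelCosetCat

end Literature.AnabelianGeometry.SemiGraphs
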